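import Summits.RiemannHypothesis.RiemannHypothesis.Theorems.WeilColumnThetaMajorantD1
import Summits.RiemannHypothesis.RiemannHypothesis.Theorems.WeilColumnThetaMellin
import Summits.RiemannHypothesis.RiemannHypothesis.Theorems.WeilColumnThetaMellinTransform
import Literature.NumberTheory.LFunctions.WeilExplicitContinuous
import HarnessLib

/-!
# The PART XIX theta WITNESS and the REAL closed forms of its certificate — DEFINITIONS (the interface of `ThetaCertificateSound`)

WEIL column (LADDER-RH, W-P(P2); tier-1 programme of director-rh 2026-08-26T00:59Z/01:00Z: ONE soundness theorem
`uc_of_thetaCheck : check r = true → UC(r.q)` behind the kernel checker `ThetaKernelCheck` of cc-s2-1). This file fixes, BY NAME,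
the objects every lemma of the programme is stated over (blueprint HOME/cc-s2-3/gen21/theory/THETA-KERNEL-BLUEPRINT v1.3 §1/§4/§5,
cc-s2-6 THETA-CERT-cc6 §0/§D; seed `(c₁, m₀, c₂)`, B-spline order `m`, window excess `δ`, cut width `η`):

* the parameters `ThetaParams` and the derived reals `a = (log q)/2 + δ`, `ε = 2δc₂`, `α`, `csum = 2 + 2α`, `λ = eᵃ/c₂`,
  `x₁ = η − a`, `u₁ = e^{x₁}`, `ζ⋆ = 2πελu₁⁻¹… = 4πδ q e^{2δ−η}` (for `c₂ = 1`);
* the witness: profile `h = profile c₁ m₀ c₂ ε α m` (`WeilColumnBSplineFourier`), `G(y) = h(y/λ)`, `Θ = thetaSum G`,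
  `G₀ = expProfile Θ`, the B-spline CDF `bsplineCDF`, the cut `χ`, `g = G₀χ`, `T = G₀(1−χ)`, the odd parts `g⁻`, `T⁻`,
  and the mollified test function `φ_k = g⁻ ⋆ moll_k` handed to the semilocal form;
* the REAL closed forms of THETA-CERT §D: `M` (D1), `M₁` (D2), `A`, `B` (D3), `M_L`, `χ_L`, `r̄`, `atom` (D4), `primesC`, `cross`
  (D6), `Jexplicit`, `arch t₀` (D7), `Rtop`, `Itop`, `Ilo J`, `gain J` (D8), `loss t₀`.

The SOUNDNESS programme is then exactly two theorems over these names: (ANALYTIC, the lane + this seat)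
`loss P t₀ < gain P J → (side conditions) → weilSemilocalThreshold (Nat.primesBelow P.q) < Real.log q⁺ / 2`, and (ARITHMETIC,
cc-s2-1) `check r = true → loss (paramsOf r) (t₀Of r) < gain (paramsOf r) 16 ∧ side conditions` (the kernel's directed-rounded
rationals dominate these reals). Definitions only (+ `rfl`-level unfolding lemmas); RH-free; nothing here bears on the truth of RH.
-/

set_option linter.dupNamespace false

noncomputable section

open MeasureTheory Set Complex
open scoped Real
open Literature.NumberTheory.LFunctions

namespace Summit.RiemannHypothesis.RiemannHypothesis.Theorems.WeilColumn.ThetaMellin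

/-! ## §1 Parameters of one certificate row -/

/-- The parameters of one theta certificate: the prime `q`, the B-spline order `m`, the window excess `δ` (`a = (log q)/2 + δ`),
the cut width `η` (THETA-CERT's `η′`), and the seed `(c₁, m₀, c₂)`. [this cell: THETA-CERT-cc6 §0; PART XIX.1] -/
structure ThetaParams where
  /-- the prime `q` (the deleted set is `S_q = {p < q}`) -/
  q : ℕ
  /-- B-spline order (`4 ≤ m ≤ 7` in tier 1) -/
  m : ℕ
  /-- window excess: `a = (log q)/2 + δ`, `0 < δ < δ_q = ½ log(q⁺/q)` -/
  δ : ℝ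
  /-- cut width (`η′ = 1/20` in tier 1) -/
  η : ℝ
  /-- seed, lower break -/
  c₁ : ℝ
  /-- seed, middle break -/
  m₀ : ℝ
  /-- seed, upper break (`= 1` in the certificates) -/
  c₂ : ℝ

namespace ThetaParams

variable (P : ThetaParams)

/-- half-window `a = (log q)/2 + δ`. -/
def a : ℝ := Real.log P.q / 2 + P.δ
/-- smoothing width `ε = 2δc₂`. -/
def ε : ℝ := 2 * P.δ * P.c₂
/-- the balancing weight `α = (c₂ − ε − m₀)/(m₀ − c₁ − ε)` (makes `∫ h = 0`). -/
def α : ℝ := (P.c₂ - P.ε - P.m₀) / (P.m₀ - P.c₁ - P.ε)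
/-- `Σ|cᵢ| = 2 + 2α` (total variation of the step profile `h₀`). -/
def csum : ℝ := 2 + 2 * P.α
/-- `h_max = max 1 α` (sup of `|h|`). -/
def hmax : ℝ := max 1 P.α
/-- the scale `λ = eᵃ/c₂` (so that `G = h(·/λ)` has top break at `eᵃ`). -/
def lam : ℝ := Real.exp P.a / P.c₂
/-- left end of the cut's transition in the additive variable: `x₁ = −a + η`. -/
def x₁ : ℝ := P.η - P.a
/-- `u₁ = e^{x₁}` (`= e^{η−δ}/√q`). -/
def u₁ : ℝ := Real.exp P.x₁
/-- `ζ⋆ = 2πελ/u₁` (`= 4πδ q e^{2δ−η}` when `c₂ = 1`): the Poisson frequency scale at the cut. -/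
def zstar : ℝ := 2 * π * P.ε * P.lam / P.u₁
/-- `ζ_{≥1}(s) = Σ_{n≥1} n^{−s}` as a real series (the form D1/D2 produce). -/
def zetaTail (s : ℕ) : ℝ := ∑' n : ℕ, 1 / ((n : ℝ) + 1) ^ s

/-! ## §2 The witness -/

/-- the profile `h = h₀ ⋆ ρ_ε` (PART XIX; `WeilColumnBSplineFourier.profile`). -/
def h : ℝ → ℂ := profile P.c₁ P.m₀ P.c₂ P.ε P.α P.m
/-- the scaled profile `G(y) = h(y/λ)` (supported in `[λc₁, λc₂] = [λc₁, eᵃ]`). -/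
def G : ℝ → ℂ := fun y => P.h (y / P.lam)
/-- the theta series `Θ(u) = Σ_{n≥1} G(nu) = Σ_{n≥1} h(nu/λ)` (`WeilColumnThetaMellin.thetaSum`). -/
def Θ : ℝ → ℂ := thetaSum P.G
/-- `G₀(x) = e^{x/2} Θ(eˣ)` (`WeilColumnThetaMellinTransform.expProfile`). -/
def G₀ : ℝ → ℂ := expProfile P.Θ

/-- The CDF of the B-spline density: `bsplineCDF c k v = ∫_{−∞}^{v} bsplineDensity c k` (real-valued; for `c = 1/m`, `k = m − 1`
this is the CDF `F` of the MEAN `S₁` of `m` uniforms on `[−1, 1]`, i.e. the Irwin–Hall CDF up to the affine change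
`F(y) = IH m (m(y+1)/2)` — the identity the arithmetic layer proves). [this cell: THETA-CERT-cc6 §0 (F = CDF of the mean; Irwin–Hall)] -/
def bsplineCDF (c : ℝ) (k : ℕ) (v : ℝ) : ℝ := ∫ t in Set.Iic v, (bsplineDensity c k t).re

/-- the cut `χ(x) = F((x + a − η/2)/(η/2))` written without the division: `χ(x) = P((η/2)·S₁ ≤ x + a − η/2)`
(`= 0` for `x ≤ −a`, `= 1` for `x ≥ −a + η`, `|χ′| ≤ m/η`). [this cell: THETA-CERT-cc6 §0 (the cut χ)] -/
def cut (x : ℝ) : ℝ := bsplineCDF (P.η / (2 * P.m)) (P.m - 1) (x + P.a - P.η / 2)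
/-- `g = G₀ · χ` (support `⊆ [−a, a]`). -/
def g (x : ℝ) : ℂ := P.G₀ x * (P.cut x : ℂ)
/-- the tail `T = G₀ · (1 − χ)` (support `⊆ (−∞, x₁]`), so that `g = G₀ − T`. -/
def T (x : ℝ) : ℂ := P.G₀ x * ((1 - P.cut x : ℝ) : ℂ)
/-- `g⁻(x) = g(x) − g(−x)`. -/
def gOdd (x : ℝ) : ℂ := P.g x - P.g (-x)
/-- `T⁻(x) = T(x) − T(−x)`. -/
def TOdd (x : ℝ) : ℂ := P.T x - P.T (-x)
/-- THE TEST FUNCTION handed to the semilocal form: `φ_k = g⁻ ⋆ moll_k` (smooth, compactly supported in `[−a − r_k, a + r_k]`). -/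
def phi (k : ℕ) : ℝ → ℂ := weilConv P.gOdd (WeilContinuous.moll k)

/-! ## §3 The real closed forms of THETA-CERT §D (what the kernel's rationals `Mhi, M1hi, Ahi, …` enclose) -/

/-- D1: `M = (Σ|cᵢ|/π)·ζ(m+1)·(m/ζ⋆)^m` — `|Θ(u)| ≤ M (u/u₁)^m`. -/
def M : ℝ := P.csum / π * zetaTail (P.m + 1) * (P.m / P.zstar) ^ P.m
/-- D2: `M₁ = 2(λ/u₁)Σ|cᵢ|(c₂ + ε(1 + m/ζ⋆))ζ(m)(m/ζ⋆)^m` — `|uΘ′(u)| ≤ M₁ (u/u₁)^{m−1}` for `u ≤ u₁`. -/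
def M₁ : ℝ := 2 * (P.lam / P.u₁) * P.csum * (P.c₂ + P.ε * (1 + P.m / P.zstar)) * zetaTail P.m * (P.m / P.zstar) ^ P.m
/-- D3: `A = 2M²u₁/(2m+1)` — `‖T⁻‖₂² ≤ A`. -/
def A : ℝ := 2 * P.M ^ 2 * P.u₁ / (2 * P.m + 1)
/-- D3: `B_in = (½ + m/η)·M·(u₁/(2m+1))^{1/2} + M₁·(u₁/(2m−1))^{1/2}` — `‖T′‖₂ ≤ B_in`. -/
def Bin : ℝ := (1 / 2 + P.m / P.η) * P.M * Real.sqrt (P.u₁ / (2 * P.m + 1)) + P.M₁ * Real.sqrt (P.u₁ / (2 * P.m - 1))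
/-- D3: `B = 2B_in²` — `‖(T⁻)′‖₂² ≤ B`. -/
def B : ℝ := 2 * P.Bin ^ 2
/-- D6: `Σ_n Λ(n) n^{−s}` (`= −ζ′/ζ(s)`), real series. -/
def vonMangoldtSum (s : ℕ) : ℝ := ∑' n : ℕ, (ArithmeticFunction.vonMangoldt n : ℝ) / (n : ℝ) ^ s
/-- D6: `primesC = (4M²u₁/(2m+1))·ΣΛ(n)n^{−(m+1)}` (the `C_T(log n)` terms over all prime powers). -/
def primesC : ℝ := 4 * P.M ^ 2 * P.u₁ / (2 * P.m + 1) * vonMangoldtSum (P.m + 1)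
/-- The Rosser–Schoenfeld constant `1.03883` (`ψ(x) < 1.03883·x` for all `x > 0`, Rosser–Schoenfeld 1962 Thm 12) as it enters `cross`. -/
def rsConst : ℝ := 103883 / 100000
/-- D6: `cross = 2·1.03883·M²·(1/m² + e^{−m/(m+1)}/(m+1))` (the `V_T(−log n)` terms, `n > N = q e^{2δ−2η}`). -/
def cross : ℝ := 2 * rsConst * P.M ^ 2 * (1 / (P.m : ℝ) ^ 2 + Real.exp (-(P.m : ℝ) / (P.m + 1)) / (P.m + 1))
/-- D7: `J(t₀) = ∫_{t₀}^∞ e^{t/2}/sinh t dt` (the arch tail integral). -/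
def Jfun (t₀ : ℝ) : ℝ := ∫ t in Set.Ioi t₀, Real.exp (t / 2) / Real.sinh t
/-- D7: the explicit majorant of `J(t₀)` for `0 < t₀ < 1`:
`log(1/t₀) + ½ + e^{1/2}/16 + 2Σ_{k≤5} e^{−(2k+½)}/(2k+½) + 2e^{−25/2}/((25/2)(1 − e^{−2}))`. -/
def Jexplicit (t₀ : ℝ) : ℝ :=
  Real.log (1 / t₀) + 1 / 2 + Real.exp (1 / 2) / 16
    + 2 * (Real.exp (-1 / 2) / (1 / 2) + Real.exp (-5 / 2) / (5 / 2) + Real.exp (-9 / 2) / (9 / 2)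
        + Real.exp (-13 / 2) / (13 / 2) + Real.exp (-17 / 2) / (17 / 2) + Real.exp (-21 / 2) / (21 / 2))
    + 2 * Real.exp (-25 / 2) / ((25 / 2) * (1 - Real.exp (-2)))
/-- D7: `C₁ = ∫₀^∞ (e^{t/2} − 1)/sinh t dt = π/2 + log 2`. -/
def archC₁ : ℝ := π / 2 + Real.log 2
/-- D7: `arch t₀ = (B/2)·e^{t₀/2}·t₀²/2 + A·(2·Jexplicit t₀ − log 4π − γ − C₁)₊` — `arch(T⁻ ⋆ T̃⁻) ≤ arch t₀` for any `0 < t₀ < 1`. -/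
def arch (t₀ : ℝ) : ℝ :=
  P.B / 2 * Real.exp (t₀ / 2) * t₀ ^ 2 / 2
    + P.A * max 0 (2 * Jexplicit t₀ - Real.log (4 * π) - Real.eulerMascheroniConstant - archC₁)
/-- D4: `M_L = M·e^{m(2δ−η)}` (`= M(e^{−a+2δ})`, the theta majorant on the bottom layer). -/
def ML : ℝ := P.M * Real.exp (P.m * (2 * P.δ - P.η))
/-- D4: `χ_L = χ(−a + 2δ)` (the cut's value at the top of the bottom layer; `= IH m (2mδ/η)`). -/
def chiL : ℝ := P.cut (2 * P.δ - P.a)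
/-- D4: `r̄ = 4δe^δ h_max M_L χ_L + 2δ(e^δ/√q) M_L² χ_L²` — `|2C_g(log q)| + |V_g(−log q)| ≤ r̄`. -/
def rbar : ℝ :=
  4 * P.δ * Real.exp P.δ * P.hmax * P.ML * P.chiL + 2 * P.δ * (Real.exp P.δ / Real.sqrt P.q) * P.ML ^ 2 * P.chiL ^ 2
/-- D4: `atom = (2 log q/√q)·r̄`. -/
def atom : ℝ := 2 * Real.log P.q / Real.sqrt P.q * P.rbar
/-- D8: the top-layer profile `R(τ) = P(S₁ ≥ 1 − τ) = 1 − F(1 − τ)` (`= IH m (mτ/2)`), `F` = CDF of the mean of `m` uniforms on `[−1,1]`. -/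
def Rtop (τ : ℝ) : ℝ := 1 - bsplineCDF (1 / P.m) (P.m - 1) (1 - τ)
/-- D8: `τ₁(w) = (1 − e^{−w})/(2δ)`. -/
def τ₁ (w : ℝ) : ℝ := (1 - Real.exp (-w)) / (2 * P.δ)
/-- D8: the exact top-layer integral `I = ∫₀^{2δ} R(τ₁(w)) R(τ₁(2δ − w)) dw` (`V_g(log q) = √q · I`). -/
def Itop : ℝ := ∫ w in (0 : ℝ)..(2 * P.δ), P.Rtop (P.τ₁ w) * P.Rtop (P.τ₁ (2 * P.δ - w))
/-- D8: the lower Riemann sum `I_lo(J) = 2 Σ_{j<J} (δ/J)·R((w_j − w_j²/2)/(2δ))·R((s_j − s_j²/2)/(2δ))`, `w_j = δj/J`,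
`s_j = 2δ − δ(j+1)/J` (`= 2·gainSum m δ J J 0` of the checker). -/
def Ilo (J : ℕ) : ℝ :=
  2 * ∑ j ∈ Finset.range J,
    P.δ / J * P.Rtop (((P.δ * j / J) - (P.δ * j / J) ^ 2 / 2) / (2 * P.δ))
      * P.Rtop (((2 * P.δ - P.δ * (j + 1) / J) - (2 * P.δ - P.δ * (j + 1) / J) ^ 2 / 2) / (2 * P.δ))
/-- D8/D9: `gain J = 2 log q · I_lo(J)`. -/
def gain (J : ℕ) : ℝ := 2 * Real.log P.q * P.Ilo J
/-- D9: `loss t₀ = primesC + cross + arch t₀ + atom`. -/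
def loss (t₀ : ℝ) : ℝ := P.primesC + P.cross + P.arch t₀ + P.atom

/-- **Admissibility** (the side conditions of THETA-CERT §D / the checker's D9 conjuncts), for the next prime `q⁺ = qn`:
`q < qn` consecutive primes is SEPARATE (`HandoffWindow.ConsecutivePrimes`); here: window strictly inside (`e^{2δ} q < qn`),
`e^{2δ} < 2`, `0 < δ`, `0 < η < a`, `3 ≤ m` and the seed inequalities `0 < c₁`, `c₁ + ε < m₀ < c₂ − ε`,
`ε < min(m₀ − c₁, c₂ − m₀)/4` (the checker has `c₂ = 1`, `4 ≤ m ≤ 7`). -/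
structure Admissible (qn : ℕ) : Prop where
  three_le : 3 ≤ P.m
  delta_pos : 0 < P.δ
  window : Real.exp (2 * P.δ) * P.q < qn
  exp_lt_two : Real.exp (2 * P.δ) < 2
  eta_pos : 0 < P.η
  eta_lt : P.η < P.a
  c₁_pos : 0 < P.c₁
  c₂_pos : 0 < P.c₂
  seed₁ : P.c₁ + P.ε < P.m₀
  seed₂ : P.m₀ < P.c₂ - P.ε
  eps_small₁ : P.ε < (P.m₀ - P.c₁) / 4
  eps_small₂ : P.ε < (P.c₂ - P.m₀) / 4

/-! ## §4 Unfolding lemmas (`rfl`-level; so that downstream files never depend on the `def` bodies silently) -/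

/-- `Θ P u = Σ' n, h(((n+1)·u)/λ)`. [folklore] -/
theorem Θ_apply (u : ℝ) : P.Θ u = ∑' n : ℕ, profile P.c₁ P.m₀ P.c₂ P.ε P.α P.m ((((n + 1 : ℕ) : ℝ) * u) / P.lam) := rfl

/-- `g = G₀ − T`. [folklore] -/
theorem g_eq_G₀_sub_T (x : ℝ) : P.g x = P.G₀ x - P.T x := by
  simp only [g, T, Complex.ofReal_sub, Complex.ofReal_one]
  ring

/-- `g⁻ = G₀⁻ − T⁻` with `G₀⁻ = oddProfile Θ`. [folklore] -/
theorem gOdd_eq (x : ℝ) : P.gOdd x = oddProfile P.Θ x - P.TOdd x := by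
  simp only [gOdd, TOdd, oddProfile, g_eq_G₀_sub_T, G₀]
  ring

/-- `g⁻` is odd. [folklore] -/
theorem gOdd_neg (x : ℝ) : P.gOdd (-x) = -P.gOdd x := by
  simp only [gOdd, neg_neg]
  ring

/-- `loss = primesC + cross + arch + atom`. [folklore] -/
theorem loss_eq (t₀ : ℝ) : P.loss t₀ = P.primesC + P.cross + P.arch t₀ + P.atom := rfl

/-- **D1 in the interface's names**: `‖Θ(u)‖ ≤ M·(u/u₁)^m` for every `u > 0`, GIVEN continuity of the profile (m ≥ 2: the lane's
`WeilColumnBSplineContinuity`) — from `norm_thetaSum_profile_le` (p417966). [this seat, D1] -/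
theorem norm_Θ_le {qn : ℕ} (hP : P.Admissible qn) (hcont : Continuous P.h) {u : ℝ} (hu : 0 < u) :
    ‖P.Θ u‖ ≤ P.M * (u / P.u₁) ^ P.m := by
  have hm : 1 ≤ P.m := le_trans (by norm_num) hP.three_le
  have hε : 0 < P.ε := by have := hP.delta_pos; have := hP.c₂_pos; unfold ε; positivity
  have hlam : 0 < P.lam := by have := hP.c₂_pos; unfold lam; positivity
  have hα : 0 ≤ P.α := div_nonneg (by linarith [hP.seed₂]) (by linarith [hP.seed₁])
  have hD1 := norm_thetaSum_profile_le (α := P.α) (lam := P.lam) hm hε hP.seed₂.le hP.seed₁ hP.c₁_pos rfl hlam hcont hu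
  rw [abs_of_nonneg hα] at hD1
  rw [Θ_apply]
  refine hD1.trans (le_of_eq ?_)
  have hu₁ : 0 < P.u₁ := Real.exp_pos _
  have hπ : 0 < π := Real.pi_pos
  have key : ((P.m : ℝ) / (2 * π * P.ε * P.lam / P.u₁)) ^ P.m * (u / P.u₁) ^ P.m
      = ((P.m : ℝ) * u / (2 * π * P.ε * P.lam)) ^ P.m := by
    rw [← mul_pow]
    congr 1
    field_simp
  simp only [M, csum, zetaTail, zstar]
  rw [mul_assoc _ (((P.m : ℝ) / (2 * π * P.ε * P.lam / P.u₁)) ^ P.m), key]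
  ring

end ThetaParams

end Summit.RiemannHypothesis.RiemannHypothesis.Theorems.WeilColumn.ThetaMellin
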